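import Mathlib
import Summits.RiemannHypothesis.RiemannHypothesis.Theorems.WeilFarCoercivityFloor
import Summits.RiemannHypothesis.RiemannHypothesis.Theorems.WeilFarFloorKappaRoot
import HarnessLib

/-!
# The floor law's threshold is immaterial: `(∃ C, FarFloorDiscrepancyLe C a₀) ↔ (∃ C, FarFloorDiscrepancyLe C 1)` (`a₀ > 0`)

Helper file (`--supports stmt-RiemannHypothesis-0098`, lead-track anchor: Weil-positivity window ladder, format-C far bound),
RH-free, pure proofs.  Seat rh-explicit-weil-1 gen9 (memo `run/shared/lean/pub/rh-explicit/rh-explicit-weil-1/FORMAT-K3.md` §10.13).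
Bookkeeping for the floor law C-XIII (`WeilFarCoercivityFloor.FarFloorDiscrepancyLe C a₀ :=
∀ a ≥ a₀, |λ_max(a) − (L(a) − 2γ_E)| ≤ C`): the kernel theorems around it come with various thresholds (`a ≥ 2`, `a ≥ 3`,
`a ≥ 4`, "for all large `a`"), the sealed law says `a₀ = 1`.  Since both sides are BOUNDED on every compact window range —
`0 ≤ λ_max(a) ≤ λ_max(a₂)` (`farCoercivityFloor_nonneg`, monotonicity) and `0 < L(a) ≤ e^{2a+2}` (`pntFloor_pos`, `pntFloor_le`,
from `½ < κ(a) ≤ 1 + 1/a`) — the threshold can be moved at the cost of the constant: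

* `farFloorDiscrepancyLe_of_pos` — `FarFloorDiscrepancyLe C a₀ → 0 < a₁ → FarFloorDiscrepancyLe (max C (λ_max(a₀) + e^{2a₀+2} + 2)) a₁`;
* ★ `exists_farFloorDiscrepancyLe_iff` — for every `a₀ > 0`: `(∃ C, FarFloorDiscrepancyLe C a₀) ↔ (∃ C, FarFloorDiscrepancyLe C 1)`.

So "C-XIII from some threshold on" and C-XIII are the same statement.  Standard axioms only.
-/

set_option linter.dupNamespace false
set_option autoImplicit false

noncomputable section

open MeasureTheory Set

namespace Summit.RiemannHypothesis.RiemannHypothesis.Theorems.WeilFormatC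

namespace FloorLaw

variable {a : ℝ}

/-! ## §1 Crude two-sided bounds of `L(a) = pntFloor a` on every window -/

/-- `½ < κ(a)` and the eigen-equation `κ sinh(κa) = cosh(κa)/2` (`FloorGrowth.sInf_pntKappaSet_spec`, restated for `pntKappa`). -/
theorem pntKappa_spec (ha : 0 < a) :
    1 / 2 < pntKappa a ∧ pntKappa a * Real.sinh (pntKappa a * a) = Real.cosh (pntKappa a * a) / 2 := by
  unfold pntKappa
  exact FloorGrowth.sInf_pntKappaSet_spec ha

/-- `κ(a) ≤ 1 + 1/a` (`1 + 1/a` lies in the defining set). -/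
theorem pntKappa_le (ha : 0 < a) : pntKappa a ≤ 1 + 1 / a := by
  unfold pntKappa
  have h1a : (0 : ℝ) < 1 / a := one_div_pos.2 ha
  refine csInf_le ⟨1 / 2, fun κ hκ ↦ hκ.1.le⟩ ⟨by linarith, ?_⟩
  have h := FloorGrowth.pntPsi_big_pos ha
  have hc : 0 < Real.cosh ((1 + 1 / a) * a) := Real.cosh_pos _
  rw [Real.tanh_eq_sinh_div_cosh, ← mul_div_assoc, le_div_iff₀ hc]
  linarith

/-- `0 < L(a)` for `a > 0`. -/
theorem pntFloor_pos (ha : 0 < a) : 0 < pntFloor a := by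
  obtain ⟨hκ, -⟩ := pntKappa_spec ha
  unfold pntFloor
  have : 0 < pntKappa a ^ 2 - 1 / 4 := by nlinarith
  exact one_div_pos.2 this

/-- `L(a) ≤ e^{2a+2}` for `a > 0` (`κ − ½ = (κ + ½)e^{−2κa} ≥ e^{−2κa} ≥ e^{−(2a+2)}`). -/
theorem pntFloor_le (ha : 0 < a) : pntFloor a ≤ Real.exp (2 * a + 2) := by
  obtain ⟨hκ, heig⟩ := pntKappa_spec ha
  have hle := pntKappa_le ha
  set κ := pntKappa a with hκdef
  have hfix := FloorGrowth.kappa_sub_half_eq heig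
  -- κ − 1/2 ≥ e^{−2κa} ≥ e^{−(2a+2)}
  have h1 : Real.exp (-(2 * a + 2)) ≤ Real.exp (-(2 * (κ * a))) := by
    rw [Real.exp_le_exp]
    have : κ * a ≤ (1 + 1 / a) * a := mul_le_mul_of_nonneg_right hle ha.le
    have h2 : (1 + 1 / a) * a = a + 1 := by field_simp
    linarith
  have h2 : Real.exp (-(2 * (κ * a))) ≤ κ - 1 / 2 := by
    rw [hfix]
    have : 1 ≤ κ + 1 / 2 := by linarith
    nlinarith [Real.exp_pos (-(2 * (κ * a)))]
  have hδ : Real.exp (-(2 * a + 2)) ≤ κ - 1 / 2 := h1.trans h2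
  have hpos : 0 < Real.exp (-(2 * a + 2)) := Real.exp_pos _
  unfold pntFloor
  rw [← hκdef]
  have hden : κ ^ 2 - 1 / 4 = (κ - 1 / 2) * (κ + 1 / 2) := by ring
  have hge : Real.exp (-(2 * a + 2)) ≤ κ ^ 2 - 1 / 4 := by
    rw [hden]
    have : κ - 1 / 2 ≤ (κ - 1 / 2) * (κ + 1 / 2) := by nlinarith
    linarith
  calc 1 / (κ ^ 2 - 1 / 4) ≤ 1 / Real.exp (-(2 * a + 2)) := one_div_le_one_div_of_le hpos hge
    _ = Real.exp (2 * a + 2) := by rw [Real.exp_neg, one_div, inv_inv]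

/-! ## §2 `0 ≤ λ_max(a)` -/

/-- `0 ≤ λ_max(a)` for `a > 0` (the window's indicator has a nonnegative quotient). -/
theorem farCoercivityFloor_nonneg (ha : 0 < a) : 0 ≤ farCoercivityFloor a := by
  set f : ℝ → ℝ := (Icc (-a) a).indicator fun _ ↦ (1 : ℝ) with hf
  have hmeas : Measurable f := measurable_const.indicator measurableSet_Icc
  have hf01 : ∀ x, 0 ≤ f x ∧ f x ≤ 1 := by
    intro x; simp only [hf, Set.indicator_apply]; split_ifs <;> simp
  have hbd : ∀ x, |f x| ≤ 1 := fun x ↦ by rw [abs_of_nonneg (hf01 x).1]; exact (hf01 x).2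
  have hsupp : ∀ x, x ∉ Icc (-a) a → f x = 0 := fun x hx ↦ by simp [hf, Set.indicator_of_notMem hx]
  have hsq : ∀ x, f x ^ 2 = (Icc (-a) a).indicator (fun _ ↦ (1 : ℝ)) x := by
    intro x; simp only [hf, Set.indicator_apply]; split_ifs <;> simp
  have hint : ∫ x, f x ^ 2 = 2 * a := by
    simp_rw [hsq]
    rw [integral_indicator measurableSet_Icc, setIntegral_const, Real.volume_real_Icc_of_le (by linarith)]
    simp; ring
  have hpos : 0 < ∫ x, f x ^ 2 := by rw [hint]; linarith
  have hQ : 0 ≤ primeShiftForm a f := by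
    unfold primeShiftForm
    refine Finset.sum_nonneg fun n _ ↦ mul_nonneg (mul_nonneg (by norm_num)
      (div_nonneg ArithmeticFunction.vonMangoldt_nonneg (Real.sqrt_nonneg _))) ?_
    exact integral_nonneg fun x ↦ mul_nonneg (hf01 _).1 (hf01 _).1
  have hle : primeShiftForm a f / ∫ x, f x ^ 2 ≤ farCoercivityFloor a :=
    le_csSup (primeShiftQuotients_bddAbove a) ⟨f, 1, hmeas, hbd, hsupp, hpos, rfl⟩
  exact le_trans (div_nonneg hQ hpos.le) hle

/-! ## §3 Moving the threshold -/

/-- On `[a₁, a₂]` (`a₁ > 0`) the discrepancy is bounded: `|λ_max(a) − (L(a) − 2γ_E)| ≤ λ_max(a₂) + e^{2a₂+2} + 2`. -/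
theorem abs_farFloorDiscrepancy_le_of_mem_Icc {a₁ a₂ : ℝ} (ha₁ : 0 < a₁) (h : a ∈ Icc a₁ a₂) :
    |farCoercivityFloor a - (pntFloor a - 2 * Real.eulerMascheroniConstant)|
      ≤ farCoercivityFloor a₂ + Real.exp (2 * a₂ + 2) + 2 := by
  have ha : 0 < a := lt_of_lt_of_le ha₁ h.1
  have h0 := farCoercivityFloor_nonneg ha
  have hm := farCoercivityFloor_mono ha h.2
  have hL0 := pntFloor_pos ha
  have hL := pntFloor_le ha
  have hL2 : Real.exp (2 * a + 2) ≤ Real.exp (2 * a₂ + 2) := Real.exp_le_exp.2 (by linarith [h.2])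
  have hγ0 := Real.one_half_lt_eulerMascheroniConstant
  have hγ1 := Real.eulerMascheroniConstant_lt_two_thirds
  rw [abs_le]
  constructor <;> linarith

/-- Monotonicity of the predicate in both parameters. -/
theorem farFloorDiscrepancyLe_mono {C C' a₀ a₀' : ℝ} (h : FarFloorDiscrepancyLe C a₀) (hC : C ≤ C') (ha : a₀ ≤ a₀') :
    FarFloorDiscrepancyLe C' a₀' :=
  fun a ha' ↦ (h a (le_trans ha ha')).trans hC

/-- **Moving the threshold**: `FarFloorDiscrepancyLe C a₀` and `0 < a₁` give
`FarFloorDiscrepancyLe (max C (λ_max(a₀) + e^{2a₀+2} + 2)) a₁`. -/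
theorem farFloorDiscrepancyLe_of_pos {C a₀ a₁ : ℝ} (h : FarFloorDiscrepancyLe C a₀) (ha₁ : 0 < a₁) :
    FarFloorDiscrepancyLe (max C (farCoercivityFloor a₀ + Real.exp (2 * a₀ + 2) + 2)) a₁ := by
  intro a ha
  rcases le_or_gt a₀ a with hle | hlt
  · exact (h a hle).trans (le_max_left _ _)
  · exact (abs_farFloorDiscrepancy_le_of_mem_Icc ha₁ ⟨ha, hlt.le⟩).trans (le_max_right _ _)

/-- **The threshold is immaterial**: for every `a₀ > 0`, `(∃ C, FarFloorDiscrepancyLe C a₀) ↔ (∃ C, FarFloorDiscrepancyLe C 1)`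
(the right-hand side with `∃ C` in front is STRUCTURE.md's conjecture C-XIII). -/
theorem exists_farFloorDiscrepancyLe_iff {a₀ : ℝ} (ha₀ : 0 < a₀) :
    (∃ C, FarFloorDiscrepancyLe C a₀) ↔ (∃ C, FarFloorDiscrepancyLe C 1) := by
  constructor
  · rintro ⟨C, hC⟩
    rcases le_or_gt a₀ 1 with h1 | h1
    · exact ⟨C, farFloorDiscrepancyLe_mono hC le_rfl h1⟩
    · exact ⟨_, farFloorDiscrepancyLe_of_pos hC one_pos⟩
  · rintro ⟨C, hC⟩
    rcases le_or_gt 1 a₀ with h1 | h1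
    · exact ⟨C, farFloorDiscrepancyLe_mono hC le_rfl h1⟩
    · exact ⟨_, farFloorDiscrepancyLe_of_pos hC ha₀⟩

/-- **"Eventually" suffices**: if `|λ_max(a) − (L(a) − 2γ_E)| ≤ C` for all large `a`, then C-XIII's predicate holds from `a₀ = 1`
with some constant. -/
theorem exists_farFloorDiscrepancyLe_of_eventually {C : ℝ}
    (h : ∀ᶠ a : ℝ in Filter.atTop, |farCoercivityFloor a - (pntFloor a - 2 * Real.eulerMascheroniConstant)| ≤ C) :
    ∃ C', FarFloorDiscrepancyLe C' 1 := by
  obtain ⟨a₀, ha₀⟩ := Filter.eventually_atTop.1 h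
  have h' : FarFloorDiscrepancyLe C (max a₀ 1) := fun a ha ↦ ha₀ a ((le_max_left _ _).trans ha)
  exact (exists_farFloorDiscrepancyLe_iff (by positivity)).1 ⟨C, h'⟩

end FloorLaw

end Summit.RiemannHypothesis.RiemannHypothesis.Theorems.WeilFormatC
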